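import Summits.QuantumFields.BalabanUV.T4Continuum.Support.SmoothRefineAbelianFlux
import Summits.QuantumFields.BalabanUV.T4Continuum.Support.MinimalActionRate
import HarnessLib

/-!
# T⁴ programme, node NE3 — the kinematic refinement lemma, abelian line, file 9: THE END — `ApproxRefine` WITH MISMATCH
# ZERO FOR `U(1)`-VALUED CONFIGURATIONS (`SmoothRefineAbelianEnd`)

Cell `pub-balaban`, NE3 formalisation swarm (`t4/formal/NE3/LEAVES.md` row S4b = «R1 in the ABELIAN case», unit
`b2b-balaban-t4-ne3-formalise-leaf-10`); sequel of `SmoothRefineAbelianFlux`.  THE ABELIAN SANITY CASE OF THE KINEMATIC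
LEMMA, KERNEL: for `1 × 1` matrices (`[Unique n]`, i.e. `U(1)`-valued configurations in the cell's vocabulary
`Matrix n n ℂ`), every unitary `(N·L^j)`-periodic configuration `U` in the small-field class of radius `b(L^j)^{−2}` whose
flux has covariant gradient `≤ c(L^j)^{−3}` pointwise IS THE EXACT RESCALED BLOCK AVERAGE (42) `rescale L (bavg L W) = U` of
a unitary `(N·L^{j+1})`-periodic `W` in the small-field class of radius `b₁(L^{j+1})^{−2}` with flux gradient
`≤ c₁(L^{j+1})^{−3}` pointwise, `b₁ = (2b + dcL²) + (2b + dcL²)²`, `c₁ = c(L + 2dL³)` — i.e. the body of the row owner's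
R1 shape `SmoothRefineOfApprox.ApproxRefine 𝒞 L N b c b₁ c₁ m` (t4-ne3-p1 (42S), staged) with MISMATCH `m = 0`, under
the smallness `K₀(d,L)·b ≤ 1`, `K₀ = 32 + 8d(2dL + 2L)(1 + 2dL + L)` (`approxRefine_abelian`; the mismatch form and the
class membership `W ∈ sfClass d L N ε (j+1)` for `b₁ ≤ ε` are the corollaries `approxRefine_abelian_mismatch`,
`mem_sfClass_refined`).

THE CONSTRUCTION (files 1–8): `W = slicePull L U · exp (neutralize L (whitneyPot L (flux U)))` — the slice pullback of
`U` (every last-slice bond of a block carries the coarse bond variable) dressed by the exponential of the NEUTRALISED cubical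
WHITNEY POTENTIAL of the coarse flux: its fine flux is EXACTLY `whitney (flux U) − cornerPull (d T(whitneyPot (flux U)))`
(Whitney refinement = `L^{−2}` × multilinear interpolation; the correction is the coarse curl of the contour averages,
`≤ d·sup‖∇F‖`), and its block average is EXACTLY `U` because the contour averages of the neutralised potential vanish.  No
fixed point, no pre-compensation: the first-order phase mismatch of a naive refinement is a coarse GRADIENT up to `O(∇F)`
and is absorbed by the slice lift.  HONEST: the constant `b₁` carries `d·c·L²` UNSPLIT (the flux mismatch sits on one corner
plaquette per block), so the class condition `b₁ ≤ ε` needs `ε ≳ 2b + dcL²` — recorded for the dictionary seat (S3) and the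
owner's R0, same structure as `b₁ + 8mL³/g ≤ ε` there.

HONEST FRAMING: finite-`T⁴` kinematics, ABELIAN sanity case of leaf R1 only (rung (B)+1 — NOT infinite volume, NOT a mass
gap, NOT Clay); NE3 NOT proved: NE3-(A) stays CONDITIONAL on ⟨(H1), (H3ˢᵘᵖ), (H0)⟩ (B11 Thm 1 TYPE) and the NON-ABELIAN
`ApproxRefine` (OPEN, rows S4c–S4e); no `BetaPertH`, no (B), no G-an2-4; no printed sentence is a hypothesis; spine
PROVED 0/9 unchanged.  PLACEMENT (human rule 2026-08-19): our work, under `Summits/QuantumFields/BalabanUV/`.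
-/

set_option autoImplicit false

open scoped BigOperators Matrix Matrix.Norms.L2Operator
open NormedSpace

namespace Summit.QuantumFields.BalabanUV.T4Continuum.SmoothRefineAbelianEnd

open Literature.MathematicalPhysics.QuantumFieldTheory.Balaban1983to89
open B7Prop1Explicit B7Prop2Explicit MatrixLog UnitaryModel
open T4AveragingDeficitWall hiding Site Plane Plaq Bond
open T4AveragingDeficitWallBoundary (IsPeriodicCfg)
open SmoothRefineBlocks SmoothRefineWhitney SmoothRefineNeutral SmoothRefineSquares SmoothRefineAbelian SmoothRefineAbelianFlux
open MinimalActionRate (sfClass)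

noncomputable section

variable {d : ℕ} {n : Type*} [Fintype n] [DecidableEq n]


/-! ## §1 One-by-one matrices commute -/

omit [DecidableEq n] in
/-- For a one-element index type, matrix multiplication is commutative. [folklore] -/
theorem mul_comm_of_unique [Unique n] (A B : (Matrix n n ℂ)) : A * B = B * A := by
  ext i j
  obtain rfl : i = default := Subsingleton.elim _ _
  obtain rfl : j = default := Subsingleton.elim _ _
  simp [Matrix.mul_apply, mul_comm]

/-- The commutative normed ring structure of `M_1(ℂ)` (operator norm), same data as the cell's `NormedRing` instance.
[folklore] -/
@[reducible] def instNormedCommRing [Unique n] : NormedCommRing (Matrix n n ℂ) :=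
  { (inferInstance : NormedRing (Matrix n n ℂ)) with mul_comm := mul_comm_of_unique }

/-- `Ad` is trivial on `M_1(ℂ)`. [folklore] -/
theorem Ad_eq_self [Unique n] (u : (Matrix n n ℂ)ˣ) (X : (Matrix n n ℂ)) : Ad u X = X := by
  unfold Ad
  rw [mul_comm_of_unique (u : (Matrix n n ℂ)) X, mul_assoc, Units.mul_inv, mul_one]

/-- On `M_1(ℂ)` the covariant gradient is the plain forward difference. [folklore] -/
theorem covGrad_eq_sub [Unique n] (V : Site d → Fin d → (Matrix n n ℂ)ˣ) (G : T4AveragingDeficitWall.Plaq d → (Matrix n n ℂ)) (x : Site d)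
    (κ : Fin d) (π : T4AveragingDeficitWall.Plane d) : covGrad V G x κ π = G (x + e κ, π) - G (x, π) := by
  rw [covGrad, Ad_eq_self]

/-! ## §2 The coarse flux cochain of a small unitary configuration on `M_1(ℂ)` -/

section End

variable [Unique n]

/-! No `local instance` is declared (the commutative structure `instNormedCommRing` is entered with `letI` inside each
statement ∕ proof that needs it, so that nothing here can override a library instance for an importer). -/

/-- The tree's `flux` on the ordered planes is the coarse flux cochain `cflux`. [folklore] -/
theorem flux_eq_cflux (V : Site d → Fin d → (Matrix n n ℂ)ˣ) (x : Site d) (π : T4AveragingDeficitWall.Plane d) :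
    letI : NormedCommRing (Matrix n n ℂ) := instNormedCommRing
    flux V (x, π) = cflux V x π.1.1 π.1.2 := rfl

/-- The coarse flux differences from the covariant-gradient bound (all pairs of directions, via antisymmetry).
[folklore] -/
theorem norm_cfd_cflux_le {U : Site d → Fin d → (Matrix n n ℂ)ˣ} {a δ : ℝ} (ha : 0 ≤ a) (ha4 : a ≤ 1 / 4) (hδ0 : 0 ≤ δ)
    (hs : SmallField U a) (hg : ∀ (x : Site d) (κ : Fin d) (π : T4AveragingDeficitWall.Plane d), ‖covGrad U (flux U) x κ π‖ ≤ δ)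
    (x : Site d) (α μ ν : Fin d) :
    letI : NormedCommRing (Matrix n n ℂ) := instNormedCommRing
    ‖cflux U (x + e α) μ ν - cflux U x μ ν‖ ≤ δ := by
  letI : NormedCommRing (Matrix n n ℂ) := instNormedCommRing
  rcases lt_trichotomy μ ν with h | rfl | h
  · have := hg x α ⟨(μ, ν), h⟩
    rwa [covGrad_eq_sub, flux_eq_cflux, flux_eq_cflux] at this
  · rw [cflux_self, cflux_self, sub_zero, norm_zero]; exact hδ0
  · have h1 := hg x α ⟨(ν, μ), h⟩
    rw [covGrad_eq_sub, flux_eq_cflux, flux_eq_cflux] at h1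
    have e1 : cflux U (x + e α) μ ν = -cflux U (x + e α) ν μ := cflux_anti ha ha4 hs (x + e α) ν μ
    have e2 : cflux U x μ ν = -cflux U x ν μ := cflux_anti ha ha4 hs x ν μ
    have e3 : cflux U (x + e α) μ ν - cflux U x μ ν = -(cflux U (x + e α) ν μ - cflux U x ν μ) := by
      rw [e1, e2]; abel
    rw [e3, norm_neg]
    exact h1

/-- The crude difference bound `4a` from `‖cflux‖ ≤ 2a`. [folklore] -/
theorem norm_cfd_cflux_le_four {U : Site d → Fin d → (Matrix n n ℂ)ˣ} {a : ℝ} (ha : 0 ≤ a) (ha2 : a ≤ 1 / 2) (hs : SmallField U a)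
    (x : Site d) (α μ ν : Fin d) :
    letI : NormedCommRing (Matrix n n ℂ) := instNormedCommRing
    ‖cflux U (x + e α) μ ν - cflux U x μ ν‖ ≤ 4 * a := by
  letI : NormedCommRing (Matrix n n ℂ) := instNormedCommRing
  exact (norm_sub_le _ _).trans (by linarith [norm_cflux_le ha ha2 hs (x + e α) μ ν, norm_cflux_le ha ha2 hs x μ ν])

/-- The coarse fluxes of a unitary configuration are skew-adjoint (B7 (22)–(23)). [folklore] -/
theorem cflux_mem_skewAdjoint {U : Site d → Fin d → (Matrix n n ℂ)ˣ} {a : ℝ} (ha : 0 ≤ a) (ha4 : a ≤ 1 / 4) (hu : IsUnitaryCfg U)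
    (hs : SmallField U a) (z : Site d) (μ ν : Fin d) :
    letI : NormedCommRing (Matrix n n ℂ) := instNormedCommRing
    cflux U z μ ν ∈ skewAdjoint (Matrix n n ℂ) := by
  letI : NormedCommRing (Matrix n n ℂ) := instNormedCommRing
  letI : CStarAlgebra (Matrix n n ℂ) := {}
  have hmem : ((hol U z (plaqWord μ ν) : (Matrix n n ℂ)ˣ) : (Matrix n n ℂ)) ∈ unitary (Matrix n n ℂ) := hol_mem_of hu z (plaqWord μ ν)
  exact skewAdjoint.mem_iff.mpr (star_mlog_eq_neg hmem ((norm_plaq_sub_one_le ha hs z μ ν).trans ha4))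

omit [Fintype n] [DecidableEq n] [Unique n] in
/-- The skew-adjoint matrices are stable under real scalars. [folklore] -/
theorem real_smul_mem_skewAdjoint (r : ℝ) (x : (Matrix n n ℂ)) (hx : x ∈ skewAdjoint (Matrix n n ℂ)) : r • x ∈ skewAdjoint (Matrix n n ℂ) := by
  rw [skewAdjoint.mem_iff] at hx ⊢
  rw [show (r • x : (Matrix n n ℂ)) = (r : ℂ) • x from rfl, star_smul, Complex.star_def, Complex.conj_ofReal, hx, smul_neg]

/-! ## §3 The refined configuration on `M_1(ℂ)`: unitarity, periodicity -/

/-- The refined configuration is `U(1)`-valued. [folklore] -/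
theorem isUnitaryCfg_refinedCfg (L : ℕ) {U : Site d → Fin d → (Matrix n n ℂ)ˣ} {a : ℝ} (ha : 0 ≤ a) (ha4 : a ≤ 1 / 4)
    (hu : IsUnitaryCfg U) (hs : SmallField U a) :
    letI : NormedCommRing (Matrix n n ℂ) := instNormedCommRing
    IsUnitaryCfg (refinedCfg L U) := by
  letI : NormedCommRing (Matrix n n ℂ) := instNormedCommRing
  intro y μ
  letI : NormedAlgebra ℚ (Matrix n n ℂ) := NormedAlgebra.restrictScalars ℚ ℂ (Matrix n n ℂ)
  have hskew : fluxPot L U y μ ∈ skewAdjoint (Matrix n n ℂ) :=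
    fluxPot_mem (skewAdjoint (Matrix n n ℂ)) real_smul_mem_skewAdjoint L (cflux_mem_skewAdjoint ha ha4 hu hs) y μ
  have hexp : (expUnit (fluxPot L U y μ) : (Matrix n n ℂ)ˣ) ∈ unitaryUnits (Matrix n n ℂ) :=
    exp_mem_unitary_of_mem_skewAdjoint hskew
  have hpull : slicePull L U y μ ∈ unitaryUnits (Matrix n n ℂ) := by
    unfold slicePull; split_ifs; exacts [hu _ _, (unitaryUnits (Matrix n n ℂ)).one_mem]
  exact (unitaryUnits (Matrix n n ℂ)).mul_mem hpull hexp

/-- The refined configuration is `(N·L^{j+1})`-periodic. [folklore] -/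
theorem isPeriodicCfg_refinedCfg {L : ℕ} (hL : 1 ≤ L) (N j : ℕ) {U : Site d → Fin d → (Matrix n n ℂ)ˣ}
    (hp : IsPeriodicCfg U ((N * L ^ j : ℕ) : ℤ)) :
    letI : NormedCommRing (Matrix n n ℂ) := instNormedCommRing
    IsPeriodicCfg (refinedCfg L U) ((N * L ^ (j + 1) : ℕ) : ℤ) := by
  letI : NormedCommRing (Matrix n n ℂ) := instNormedCommRing
  intro y κ μ
  have : ((N * L ^ (j + 1) : ℕ) : ℤ) = (L : ℤ) * ((N * L ^ j : ℕ) : ℤ) := by push_cast; ring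
  rw [this]
  exact refinedCfg_add_period hL U hp y κ μ

/-! ## §4 THE END: `ApproxRefine` with mismatch zero in the abelian case -/

variable (d) in
/-- The smallness constant `K₀(d,L) = 32 + 8d(2dL + 2L)(1 + 2dL + L)`. [folklore] -/
def K0 (L : ℕ) : ℝ := 32 + 8 * d * ((2 * (d * L) + L + L) * (1 + (2 * (d * L) + L)))

variable (d) in
/-- The output small-field constant `b₁ = (2b + dcL²) + (2b + dcL²)²`. [folklore] -/
def b1 (L : ℕ) (b c : ℝ) : ℝ := (2 * b + d * c * (L : ℝ) ^ 2) + (2 * b + d * c * (L : ℝ) ^ 2) ^ 2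

variable (d) in
/-- The output flux-gradient constant `c₁ = c(L + 2dL³)`. [folklore] -/
def c1 (L : ℕ) (c : ℝ) : ℝ := c * ((L : ℝ) + 2 * d * (L : ℝ) ^ 3)

/-- **THE ABELIAN KINEMATIC LEMMA (R1 with mismatch zero)**: see the module header. [folklore] -/
theorem approxRefine_abelian {L N : ℕ} (hL : 1 ≤ L) {b c : ℝ} (hb0 : 0 ≤ b) (hc0 : 0 ≤ c) (hb : K0 d L * b ≤ 1) {j : ℕ}
    {U : Site d → Fin d → (Matrix n n ℂ)ˣ} (hu : IsUnitaryCfg U) (hp : IsPeriodicCfg U ((N * L ^ j : ℕ) : ℤ))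
    (hs : SmallField U (b / ((L : ℝ) ^ j) ^ 2))
    (hg : ∀ (x : Site d) (κ : Fin d) (π : T4AveragingDeficitWall.Plane d),
      ‖covGrad U (flux U) x κ π‖ ≤ c / ((L : ℝ) ^ j) ^ 3) :
    ∃ W : Site d → Fin d → (Matrix n n ℂ)ˣ, IsUnitaryCfg W ∧ IsPeriodicCfg W ((N * L ^ (j + 1) : ℕ) : ℤ) ∧
      SmallField W (b1 d L b c / ((L : ℝ) ^ (j + 1)) ^ 2) ∧
      (∀ (x : Site d) (κ : Fin d) (π : T4AveragingDeficitWall.Plane d),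
        ‖covGrad W (flux W) x κ π‖ ≤ c1 d L c / ((L : ℝ) ^ (j + 1)) ^ 3) ∧
      rescale L (bavg L W) = U := by
  letI : NormedCommRing (Matrix n n ℂ) := instNormedCommRing
  -- scales
  have hL1 : (1 : ℝ) ≤ L := by exact_mod_cast hL
  have hL0 : (0 : ℝ) < L := by linarith
  set s : ℝ := (L : ℝ) ^ j with hsdef
  have hs1 : 1 ≤ s := one_le_pow₀ hL1
  have hs0 : 0 < s := by linarith
  set a : ℝ := b / s ^ 2 with hadef
  set δ₀ : ℝ := c / s ^ 3 with hδ₀def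
  set δ : ℝ := min δ₀ (4 * a) with hδdef
  have ha0 : 0 ≤ a := by positivity
  have hab : a ≤ b := by
    rw [hadef]; exact div_le_self hb0 (one_le_pow₀ hs1)
  -- smallness from `K0 d L * b ≤ 1`
  have hK : 32 + 8 * (d : ℝ) * ((2 * (d * L) + L + L) * (1 + (2 * (d * L) + L))) = K0 d L := rfl
  have hd0 : (0 : ℝ) ≤ d := Nat.cast_nonneg d
  have hP0 : (0 : ℝ) ≤ 8 * d * ((2 * (d * L) + L + L) * (1 + (2 * (d * L) + L))) := by positivity
  have hb32 : b ≤ 1 / 32 := by nlinarith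
  have ha32 : a ≤ 1 / 32 := hab.trans hb32
  have ha4 : a ≤ 1 / 4 := by linarith
  have ha2 : a ≤ 1 / 2 := by linarith
  have hsm : ((2 * (d * L) + L + L : ℕ) : ℝ) * ((1 + (2 * (d * L) + L)) * (d * (2 * a))) ≤ 1 / 2 := by
    push_cast
    have : ((2 * ((d : ℝ) * L) + L + L) * ((1 + (2 * (d * L) + L)) * (d * (2 * b)))) ≤ 1 / 2 := by nlinarith
    refine le_trans ?_ this
    gcongr
  have hδ0 : 0 ≤ δ := le_min (by positivity) (by positivity)
  have hδle : δ ≤ δ₀ := min_le_left _ _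
  have hδ4 : δ ≤ 4 * a := min_le_right _ _
  have hφ2 : 2 * a / (L : ℝ) ^ 2 + d * δ ≤ 1 / 2 := by
    have h1 : 2 * a / (L : ℝ) ^ 2 ≤ 2 * a := div_le_self (by positivity) (one_le_pow₀ hL1)
    have h2 : (d : ℝ) * δ ≤ d * (4 * a) := mul_le_mul_of_nonneg_left hδ4 hd0
    have hX : (1 : ℝ) ≤ (2 * ((d : ℝ) * L) + L + L) * (1 + (2 * (d * L) + L)) :=
      one_le_mul_of_one_le_of_one_le (by nlinarith) (by nlinarith)
    have h3 : (4 + 8 * (d : ℝ)) * b ≤ 1 := by nlinarith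
    nlinarith
  have hφ1 : 2 * a / (L : ℝ) ^ 2 + d * δ ≤ 1 := hφ2.trans (by norm_num)
  -- the hypotheses of the generic files
  have hδ : ∀ (x : Site d) (α μ ν : Fin d), ‖cflux U (x + e α) μ ν - cflux U x μ ν‖ ≤ δ := fun x α μ ν =>
    le_min (norm_cfd_cflux_le ha0 ha4 (by positivity) hs hg x α μ ν) (norm_cfd_cflux_le_four ha0 ha2 hs x α μ ν)
  have hanti := cflux_anti ha0 ha4 hs
  have hclosed := cflux_closed ha0 ha32 hs
  refine ⟨refinedCfg L U, isUnitaryCfg_refinedCfg L ha0 ha4 hu hs, isPeriodicCfg_refinedCfg hL N j hp, ?_, ?_,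
    rescale_bavg_refinedCfg hL ha0 ha2 hs hsm⟩
  · -- small field
    intro x κ κ' hκ
    have h := norm_hol_refinedCfg_plaqWord_sub_one_le hL ha0 ha32 hs hδ0 hδ hφ1 x hκ
    refine h.trans ?_
    -- `φ ≤ (2b + dcL²)/(L s)²` and `φ² ≤ (2b + dcL²)²/(L s)²`
    set φ : ℝ := 2 * a / (L : ℝ) ^ 2 + d * δ with hφdef
    set B : ℝ := 2 * b + d * c * (L : ℝ) ^ 2 with hBdef
    have hφ0 : 0 ≤ φ := by positivity
    have hB0 : 0 ≤ B := by positivity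
    have hLs : ((L : ℝ) ^ (j + 1)) ^ 2 = (L : ℝ) ^ 2 * s ^ 2 := by rw [hsdef]; ring
    have hkey : φ ≤ B / ((L : ℝ) ^ 2 * s ^ 2) := by
      rw [hφdef, hBdef, hadef]
      have h1 : (d : ℝ) * δ ≤ d * (c / s ^ 3) := mul_le_mul_of_nonneg_left hδle hd0
      have h2 : (d : ℝ) * (c / s ^ 3) ≤ d * c * (L : ℝ) ^ 2 / ((L : ℝ) ^ 2 * s ^ 2) := by
        have hs3 : s ^ 2 ≤ s ^ 3 := pow_le_pow_right₀ hs1 (by norm_num)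
        calc (d : ℝ) * (c / s ^ 3) = d * c / s ^ 3 := by ring
          _ ≤ d * c / s ^ 2 := div_le_div_of_nonneg_left (by positivity) (by positivity) hs3
          _ = d * c * (L : ℝ) ^ 2 / ((L : ℝ) ^ 2 * s ^ 2) := by field_simp
      have h3 : 2 * (b / s ^ 2) / (L : ℝ) ^ 2 = 2 * b / ((L : ℝ) ^ 2 * s ^ 2) := by
        field_simp
      rw [h3, add_div]
      linarith
    have hφB : φ ≤ B := hkey.trans (div_le_self hB0 (one_le_mul_of_one_le_of_one_le (one_le_pow₀ hL1) (one_le_pow₀ hs1)))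
    calc φ + φ ^ 2 ≤ B / ((L : ℝ) ^ 2 * s ^ 2) + B * (B / ((L : ℝ) ^ 2 * s ^ 2)) := by
          refine add_le_add hkey ?_
          rw [sq]; exact mul_le_mul hφB hkey hφ0 hB0
      _ = b1 d L b c / ((L : ℝ) ^ (j + 1)) ^ 2 := by rw [hLs, b1, ← hBdef]; ring
  · -- flux gradient
    intro x κ π
    have hne : π.1.1 ≠ π.1.2 := ne_of_lt π.2
    rw [covGrad_eq_sub, flux, flux, show fhol (refinedCfg L U) (x + e κ, π) = hol (refinedCfg L U) (x + e κ)
        (plaqWord π.1.1 π.1.2) from rfl, show fhol (refinedCfg L U) (x, π) = hol (refinedCfg L U) x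
        (plaqWord π.1.1 π.1.2) from rfl,
      mlog_hol_refinedCfg_plaqWord hL ha0 ha32 hs hδ0 hδ hφ2 _ hne,
      mlog_hol_refinedCfg_plaqWord hL ha0 ha32 hs hδ0 hδ hφ2 _ hne]
    refine (norm_fineFlux_fd_le hL hanti hclosed hδ0 hδ x κ hne).trans ?_
    have hLs : ((L : ℝ) ^ (j + 1)) ^ 3 = (L : ℝ) ^ 3 * s ^ 3 := by rw [hsdef]; ring
    rw [hLs, c1]
    have h1 : δ / (L : ℝ) ^ 2 + 2 * d * δ ≤ δ₀ / (L : ℝ) ^ 2 + 2 * d * δ₀ :=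
      add_le_add (div_le_div_of_nonneg_right hδle (by positivity)) (by nlinarith)
    refine h1.trans (le_of_eq ?_)
    rw [hδ₀def]
    field_simp

/-- The END in the owner's MISMATCH form (any `m ≥ 0`): the rescaled average is within `m(L^j)^{−3}` of `U` — indeed
equal to it. [folklore] -/
theorem approxRefine_abelian_mismatch {L N : ℕ} (hL : 1 ≤ L) {b c m : ℝ} (hb0 : 0 ≤ b) (hc0 : 0 ≤ c) (hm : 0 ≤ m)
    (hb : K0 d L * b ≤ 1) {j : ℕ} {U : Site d → Fin d → (Matrix n n ℂ)ˣ} (hu : IsUnitaryCfg U) (hp : IsPeriodicCfg U ((N * L ^ j : ℕ) : ℤ))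
    (hs : SmallField U (b / ((L : ℝ) ^ j) ^ 2))
    (hg : ∀ (x : Site d) (κ : Fin d) (π : T4AveragingDeficitWall.Plane d),
      ‖covGrad U (flux U) x κ π‖ ≤ c / ((L : ℝ) ^ j) ^ 3) :
    ∃ W : Site d → Fin d → (Matrix n n ℂ)ˣ, IsUnitaryCfg W ∧ IsPeriodicCfg W ((N * L ^ (j + 1) : ℕ) : ℤ) ∧
      SmallField W (b1 d L b c / ((L : ℝ) ^ (j + 1)) ^ 2) ∧
      (∀ (x : Site d) (κ : Fin d) (π : T4AveragingDeficitWall.Plane d),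
        ‖covGrad W (flux W) x κ π‖ ≤ c1 d L c / ((L : ℝ) ^ (j + 1)) ^ 3) ∧
      ∀ (z : Site d) (κ : Fin d), ‖((U z κ : (Matrix n n ℂ)ˣ) : (Matrix n n ℂ)) - ((rescale L (bavg L W) z κ : (Matrix n n ℂ)ˣ) : (Matrix n n ℂ))‖ ≤ m / ((L : ℝ) ^ j) ^ 3 := by
  obtain ⟨W, h1, h2, h3, h4, h5⟩ := approxRefine_abelian hL hb0 hc0 hb hu hp hs hg
  refine ⟨W, h1, h2, h3, h4, fun z κ => ?_⟩
  rw [h5, sub_self, norm_zero]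
  positivity

omit [Unique n] in
/-- CLASS MEMBERSHIP of the refinement: `W ∈ sfClass d L N ε (j+1)` as soon as `b₁ ≤ ε`. [folklore] -/
theorem mem_sfClass_of_refined {L N j : ℕ} {ε b c : ℝ} (hε : b1 d L b c ≤ ε) {W : Site d → Fin d → (Matrix n n ℂ)ˣ}
    (h1 : IsUnitaryCfg W) (h2 : IsPeriodicCfg W ((N * L ^ (j + 1) : ℕ) : ℤ))
    (h3 : SmallField W (b1 d L b c / ((L : ℝ) ^ (j + 1)) ^ 2)) : W ∈ sfClass d L N ε (j + 1) :=
  ⟨h1, h2, MinimalActionRate.SmallField.mono h3 (div_le_div_of_nonneg_right hε (by positivity))⟩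

end End

end

end Summit.QuantumFields.BalabanUV.T4Continuum.SmoothRefineAbelianEnd
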